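import Mathlib
import Summits.MatrixMultiplication.MatrixMultiplication.Theorems.LevelGradedCohnUmansLevelOneGL2DesignsRealLiftNoWrap
import Summits.MatrixMultiplication.MatrixMultiplication.Theorems.LevelGradedCohnUmansLevelOneGL2DesignsCyclotomicLiftElements
import Summits.MatrixMultiplication.MatrixMultiplication.Theorems.LevelGradedCohnUmansLevelOneGL2DesignsTangencyParabolaLift

/-!
# Cyclotomic real lift — the strong representative systems (Pohoata 2026, Prop. 5.1, for every
prime `r = 2d + 1`)
(crux `LevelOneGL2Designs`, stmt-MatrixMultiplication-14080, wall stub `stub_tangencySets`;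
wall-breaker axis k8/12 "parabola lifts over finite fields", generation 1)

Fix `d ≥ 1` with `2d + 1` prime, a prime `p` and a primitive `(2d+1)`-st root of unity `g` of
`ZMod p` (these exist iff `p ≡ 1 (mod 2d+1)`), and `M` with `(24 d² M²)^d < p`.  With the real
integers `x c = ∑_j c_j (ζ^j + ζ^{-j}) ∈ ℤ[ζ_{2d+1}]` of the companion file `…CyclotomicLiftElements`:

* abscissae  `T = {red_g (x c) : c ∈ [-M, M]^d}`                      (`(2M+1)^d` of them),
* ordinates  `S = {red_g (x (ext b)) : b ∈ [-M², M²]^{d-1} × {0}}`     (`(2M²+1)^{d-1}`, trace zero),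

the product `T × S` is parabola-free in `𝔽_p²` — a coincidence `(t − t')² = s − s'` pulls back to
`w = (x c − x c')² − (x(ext b) − x(ext b')) ∈ ℤ[ζ]` killed by BOTH reductions `ζ ↦ g^{±1}`
(they agree on real elements), with all conjugates `≤ 24 d² M²`, hence `|N(w)| < p²` and `w = 0`
(`RealLift.eq_zero_of_two_kernels`); then `Tr((x c − x c')²) = Tr(trace-zero) = 0` forces
`x c = x c'` (`RealLift.trace_sq_pos_of_real`).  The parabola lift
`ParabolaLift.srs_of_sqDiff_disjoint` turns `T × S` into a strong representative system of
`AG(2,p)` in the exact flag format of `stub_tangencySets`: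

* `cyclotomicLift_srs` : `(2M+1)^d (2M²+1)^{d−1} ≤ |F| + 2 (2M²+1)^{d−1}`.

With `M ≍ p^{1/(2d)}` this is `|F| ≳_d p^{3/2 − 1/d}` (file `…CyclotomicLiftExponent`).  The case
`d = 5` (`r = 11`) recovers seat k11's `TraceLift` files (exponent `13/10`); `d → ∞` gives the
stub's format at every exponent `< 3/2`.  Nothing here reaches the stub's `c · p^{3/2}` (`ε = 0`).

References: C. Pohoata, *The sharp exponent for the minimal distance problem*, arXiv:2607.20422
(2026), Prop. 5.1 [bib: Pohoata2026SharpExponentMinimalDistance].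
-/

-- justification: the summit/problem path `MatrixMultiplication.MatrixMultiplication` is fixed by the
-- tree layout (D-0017), so the namespace necessarily repeats a component.
set_option linter.dupNamespace false
-- justification: `CyclotomicField` is a plain `def`; Mathlib itself elaborates its instances under
-- this option (see `Mathlib/NumberTheory/NumberField/Cyclotomic/Basic.lean`).
set_option backward.isDefEq.respectTransparency false

noncomputable section

open NumberField IsCyclotomicExtension Polynomial Finset Matrix

namespace Summit.MatrixMultiplication.MatrixMultiplication.Theorems.LevelOneGL2Designs.CyclotomicLift

open RealLift ParabolaLift

variable (d : ℕ)

/-! ### Coefficient boxes -/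

/-- The box of abscissa coefficient vectors `[-M, M]^d`. -/
def boxX (M : ℕ) : Finset (Fin d → ℤ) := Fintype.piFinset fun _ => Finset.Icc (-(M : ℤ)) M

/-- The box of ordinate coefficient vectors: `[-R, R]` in the first `d - 1` coordinates, `0` in
the last one. -/
def boxB (R : ℕ) : Finset (Fin d → ℤ) :=
  Fintype.piFinset fun j => if (j : ℕ) = d - 1 then {0} else Finset.Icc (-(R : ℤ)) R

/-- `|[-M, M]^d| = (2M+1)^d`. -/
theorem card_boxX (M : ℕ) : (boxX d M).card = (2 * M + 1) ^ d := by
  rw [boxX, Fintype.card_piFinset, Finset.prod_const, Finset.card_univ, Fintype.card_fin,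
    Int.card_Icc]
  congr 1
  omega

/-- `|[-R, R]^{d-1} × {0}| = (2R+1)^{d-1}`. -/
theorem card_boxB (hd : 0 < d) (R : ℕ) : (boxB d R).card = (2 * R + 1) ^ (d - 1) := by
  rw [boxB, Fintype.card_piFinset]
  have : ∀ j : Fin d, (if (j : ℕ) = d - 1 then ({0} : Finset ℤ) else Finset.Icc (-(R : ℤ)) R).card
      = if (j : ℕ) = d - 1 then 1 else 2 * R + 1 := by
    intro j
    split_ifs
    · rfl
    · rw [Int.card_Icc]; omega
  simp_rw [this]
  rw [Finset.prod_ite, Finset.prod_const_one, one_mul, Finset.prod_const]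
  congr 1
  have hfilter : (univ.filter fun j : Fin d => ¬ (j : ℕ) = d - 1) = univ.erase ⟨d - 1, by omega⟩ := by
    ext j
    simp [Fin.ext_iff]
  rw [hfilter, Finset.card_erase_of_mem (Finset.mem_univ _), Finset.card_univ, Fintype.card_fin]

/-- Coordinates of vectors in `boxX M` are bounded by `M`. -/
theorem mem_boxX {M : ℕ} {c : Fin d → ℤ} (hc : c ∈ boxX d M) (j : Fin d) : |c j| ≤ M := by
  have := Fintype.mem_piFinset.mp hc j
  rw [Finset.mem_Icc] at this
  exact abs_le.mpr this

/-- Coordinates of vectors in `boxB R` are bounded by `R`. -/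
theorem mem_boxB {R : ℕ} {b : Fin d → ℤ} (hb : b ∈ boxB d R) (j : Fin d) : |b j| ≤ R := by
  have := Fintype.mem_piFinset.mp hb j
  split_ifs at this with h
  · rw [Finset.mem_singleton] at this
    rw [this]; simp
  · rw [Finset.mem_Icc] at this
    exact abs_le.mpr this

/-- The last coordinate of a vector in `boxB R` vanishes. -/
theorem mem_boxB_last {R : ℕ} {b : Fin d → ℤ} (hb : b ∈ boxB d R) (j : Fin d)
    (hj : (j : ℕ) = d - 1) : b j = 0 := by
  have := Fintype.mem_piFinset.mp hb j
  rw [if_pos hj, Finset.mem_singleton] at this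
  exact this

/-- Conjugate bound for a difference of box elements. -/
theorem norm_embedding_x_sub_le (σ : K d →ₐ[ℚ] ℂ) {M : ℕ} {c c' : Fin d → ℤ}
    (hc : c ∈ boxX d M) (hc' : c' ∈ boxX d M) :
    ‖σ (algebraMap (𝓞 (K d)) (K d) (x d (c - c')))‖ ≤ (d + d : ℕ) * (2 * M) := by
  refine norm_embedding_x_le d σ (c - c') fun j => ?_
  rw [Pi.sub_apply, Int.cast_sub]
  have h1 : |(c j : ℝ)| ≤ M := by exact_mod_cast mem_boxX d hc j
  have h2 : |(c' j : ℝ)| ≤ M := by exact_mod_cast mem_boxX d hc' j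
  calc |(c j : ℝ) - c' j| ≤ |(c j : ℝ)| + |(c' j : ℝ)| := abs_sub _ _
    _ ≤ M + M := add_le_add h1 h2
    _ = 2 * M := by ring

/-- Conjugate bound for a difference of trace-zero box elements. -/
theorem norm_embedding_x_ext_sub_le (σ : K d →ₐ[ℚ] ℂ) {R : ℕ} {b b' : Fin d → ℤ}
    (hb : b ∈ boxB d R) (hb' : b' ∈ boxB d R) :
    ‖σ (algebraMap (𝓞 (K d)) (K d) (x d (ext d (b - b'))))‖ ≤
      (d + d : ℕ) * ((d + 1 : ℕ) * (2 * (R : ℝ))) := by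
  refine norm_embedding_x_le d σ (ext d (b - b')) fun j => ?_
  have h := abs_ext_le d (b - b') (R := 2 * R) (fun j => ?_) j
  · exact_mod_cast h
  · rw [Pi.sub_apply]
    calc |b j - b' j| ≤ |b j| + |b' j| := abs_sub _ _
      _ ≤ R + R := add_le_add (mem_boxB d hb j) (mem_boxB d hb' j)
      _ = 2 * R := by ring

variable [hr : Fact (Nat.Prime (d + d + 1))] {p : ℕ} [hp : Fact p.Prime]

/-- `[K : ℚ] = 2d`. -/
theorem finrank_K : Module.finrank ℚ (K d) = d + d := by
  rw [IsCyclotomicExtension.Rat.finrank (d + d + 1) (K d), Nat.totient_prime hr.out]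
  omega

omit hp in
/-- **Norm window.**  If all conjugates of `w ∈ 𝓞 K` have modulus `≤ B` and `B^d < p`, then
`|N(w)| < p²`. -/
theorem natAbs_norm_lt_sq (w : 𝓞 (K d)) {B : ℝ} (hB0 : 0 ≤ B)
    (hB : ∀ σ : K d →ₐ[ℚ] ℂ, ‖σ (algebraMap (𝓞 (K d)) (K d) w)‖ ≤ B) (hlt : B ^ d < p) :
    (Algebra.norm ℤ w).natAbs < p ^ 2 := by
  have h1 := natAbs_norm_le_pow w hB
  rw [finrank_K] at h1
  have h2 : B ^ (d + d) < (p : ℝ) ^ 2 := by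
    rw [pow_add, sq]
    exact mul_lt_mul'' hlt hlt (pow_nonneg hB0 _) (pow_nonneg hB0 _)
  exact_mod_cast h1.trans_lt h2

/-- **No wrap-around for real lifted elements.**  A `w ∈ 𝓞 K` killed by both reductions
`ζ ↦ g`, `ζ ↦ g⁻¹` and with all conjugates of modulus `≤ B`, `B^d < p`, vanishes. -/
theorem eq_zero_of_red (g : ZMod p) (hg : IsPrimitiveRoot g (d + d + 1)) {w : 𝓞 (K d)}
    (h1 : red d g hg w = 0) (h2 : red d g⁻¹ (isPrimitiveRoot_inv d hg) w = 0) {B : ℝ} (hB0 : 0 ≤ B)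
    (hB : ∀ σ : K d →ₐ[ℚ] ℂ, ‖σ (algebraMap (𝓞 (K d)) (K d) w)‖ ≤ B) (hlt : B ^ d < p) : w = 0 :=
  eq_zero_of_two_kernels _ _ (ker_red_ne d g hg) h1 h2 (natAbs_norm_lt_sq d w hB0 hB hlt)

/-- **The cyclotomic real lift at a fixed prime** (Pohoata 2026, Prop. 5.1 for `K = ℚ(ζ_{2d+1})⁺`,
in the format of `stub_tangencySets`).  Let `2d + 1` be prime, `p` a prime possessing a primitive
`(2d+1)`-st root of unity `g` (i.e. `p ≡ 1 (mod 2d+1)`), and `M` with `(24 d² M²)^d < p`.  Then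
`AG(2,p)` contains a strong representative system with at least
`(2M+1)^d (2M²+1)^{d-1} − 2 (2M²+1)^{d-1}` flags: abscissae = reductions of the real integers
`∑ c_j (ζ^j + ζ^{-j})`, `|c_j| ≤ M`; ordinate shifts = reductions of the TRACE-ZERO real integers
with coefficients `≤ M²`; a coincidence `(t − t')² = s − s'` in `𝔽_p` lifts (no wrap-around, norms
`< p²` under two conjugate reductions) to `𝓞 K`, where the trace kills it. -/
theorem cyclotomicLift_srs (hd : 0 < d) (g : ZMod p) (hg : IsPrimitiveRoot g (d + d + 1)) (M : ℕ)
    (hM : (24 * d ^ 2 * M ^ 2) ^ d < p) :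
    ∃ F : Finset ((Fin 2 → ZMod p) × (Fin 2 → ZMod p)),
      (2 * M + 1) ^ d * (2 * M ^ 2 + 1) ^ (d - 1) ≤ F.card + 2 * (2 * M ^ 2 + 1) ^ (d - 1) ∧
      ∀ f ∈ F, ∀ f' ∈ F, (dotProduct f.1 f'.2 = 1 ↔ f = f') := by
  classical
  set φ := red d g hg with hφ
  set φ' := red d g⁻¹ (isPrimitiveRoot_inv d hg) with hφ'
  set T : Finset (ZMod p) := (boxX d M).image fun c => φ (x d c) with hT
  set S : Finset (ZMod p) := (boxB d (M ^ 2)).image fun b => φ (x d (ext d b)) with hS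
  -- the real bound
  set B : ℝ := 24 * (d : ℝ) ^ 2 * (M : ℝ) ^ 2 with hB
  have hB0 : 0 ≤ B := by positivity
  have hBp : B ^ d < p := by
    have : ((24 * d ^ 2 * M ^ 2) ^ d : ℕ) < (p : ℝ) := by exact_mod_cast hM
    push_cast at this
    exact this
  have hd1 : (1 : ℝ) ≤ d := by exact_mod_cast hd
  -- the key step: no coincidences
  have key : ∀ c ∈ boxX d M, ∀ c' ∈ boxX d M, ∀ b ∈ boxB d (M ^ 2), ∀ b' ∈ boxB d (M ^ 2),
      (φ (x d c) - φ (x d c')) ^ 2 = φ (x d (ext d b)) - φ (x d (ext d b')) →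
        x d c = x d c' ∧ x d (ext d b) = x d (ext d b') := by
    intro c hc c' hc' b hb b' hb' h
    set w : 𝓞 (K d) := (x d (c - c')) ^ 2 - x d (ext d (b - b')) with hw
    have hw1 : φ w = 0 := by
      rw [hw, map_sub, map_pow, ← x_sub, ← ext_sub, ← x_sub, map_sub, map_sub, h, sub_self]
    have hw2 : φ' w = 0 := by
      rw [hw, map_sub, map_pow, ← x_sub, ← ext_sub, ← x_sub, map_sub, map_sub, hφ',
        red_inv_x d g hg, red_inv_x d g hg, red_inv_x d g hg, red_inv_x d g hg, ← hφ, h, sub_self]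
    have hwB : ∀ σ : K d →ₐ[ℚ] ℂ, ‖σ (algebraMap (𝓞 (K d)) (K d) w)‖ ≤ B := by
      intro σ
      rw [hw, map_sub, map_pow, map_sub, map_pow]
      refine (norm_sub_le _ _).trans ?_
      rw [norm_pow]
      have e1 := norm_embedding_x_sub_le d σ hc hc'
      have e2 := norm_embedding_x_ext_sub_le d σ hb hb'
      have e1' : ‖σ (algebraMap (𝓞 (K d)) (K d) (x d (c - c')))‖ ^ 2 ≤
          ((d + d : ℕ) * (2 * (M : ℝ))) ^ 2 :=
        pow_le_pow_left₀ (norm_nonneg _) e1 2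
      calc _ ≤ ((d + d : ℕ) * (2 * (M : ℝ))) ^ 2 + (d + d : ℕ) * ((d + 1 : ℕ) * (2 * ((M ^ 2 : ℕ) : ℝ))) :=
            add_le_add e1' e2
        _ = (20 * (d : ℝ) ^ 2 + 4 * d) * (M : ℝ) ^ 2 := by push_cast; ring
        _ ≤ B := by
            rw [hB]
            have : (20 * (d : ℝ) ^ 2 + 4 * d) ≤ 24 * (d : ℝ) ^ 2 := by nlinarith
            exact mul_le_mul_of_nonneg_right this (by positivity)
    have hw0 : w = 0 := eq_zero_of_red d g hg hw1 hw2 hB0 hwB hBp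
    -- lift to `K` and take traces
    have hK : (algebraMap (𝓞 (K d)) (K d) (x d (c - c'))) ^ 2 =
        algebraMap (𝓞 (K d)) (K d) (x d (ext d (b - b'))) := by
      rw [← map_pow, ← sub_eq_zero, ← map_sub, ← hw, hw0, map_zero]
    have htr := congrArg (Algebra.trace ℚ (K d)) hK
    have h0 : Algebra.trace ℚ (K d) (algebraMap (𝓞 (K d)) (K d) (x d (ext d (b - b')))) = 0 := by
      rw [← ext_sub, ← x_sub, map_sub, map_sub, trace_x_ext d hd, trace_x_ext d hd, sub_self]
    rw [h0] at htr
    have hxx : algebraMap (𝓞 (K d)) (K d) (x d (c - c')) = 0 := by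
      by_contra hne
      exact (trace_sq_pos_of_real (conj_embedding_x d · (c - c')) hne).ne' htr
    have hcc : x d c = x d c' := by
      rw [← sub_eq_zero, x_sub]
      exact (map_eq_zero_iff _ (RingOfIntegers.coe_injective)).mp hxx
    refine ⟨hcc, ?_⟩
    rw [← sub_eq_zero, x_sub, ext_sub]
    have : algebraMap (𝓞 (K d)) (K d) (x d (ext d (b - b'))) = 0 := by
      rw [← hK, hxx]; ring
    exact (map_eq_zero_iff _ (RingOfIntegers.coe_injective)).mp this
  -- injectivity of the two parametrisations
  have hinjT : Set.InjOn (fun c => φ (x d c)) (boxX d M) := by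
    intro c hc c' hc' h
    obtain ⟨b, hb⟩ : (boxB d (M ^ 2)).Nonempty := by
      rw [← Finset.card_pos, card_boxB d hd]; positivity
    have := (key c hc c' hc' b hb b hb (by simp only at h; rw [h]; ring)).1
    exact x_injective d this
  have hinjS : Set.InjOn (fun b => φ (x d (ext d b))) (boxB d (M ^ 2)) := by
    intro b hb b' hb' h
    obtain ⟨c, hc⟩ : (boxX d M).Nonempty := by
      rw [← Finset.card_pos, card_boxX]; positivity
    have := (key c hc c hc b hb b' hb' (by simp only at h; rw [h]; ring)).2
    have hext := x_injective d this
    exact ext_injOn d (fun j hj => mem_boxB_last d hb j hj) (fun j hj => mem_boxB_last d hb' j hj) hext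
  have hTcard : T.card = (2 * M + 1) ^ d := by
    rw [hT, Finset.card_image_of_injOn hinjT, card_boxX]
  have hScard : S.card = (2 * M ^ 2 + 1) ^ (d - 1) := by
    rw [hS, Finset.card_image_of_injOn hinjS, card_boxB d hd]
  -- apply the parabola lift
  obtain ⟨F, hF, hprop⟩ := srs_of_sqDiff_disjoint T S (by
    intro t ht s hs t' ht' s' hs' h
    rw [hT, Finset.mem_image] at ht ht'
    rw [hS, Finset.mem_image] at hs hs'
    obtain ⟨c, hc, rfl⟩ := ht
    obtain ⟨c', hc', rfl⟩ := ht'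
    obtain ⟨b, hb, rfl⟩ := hs
    obtain ⟨b', hb', rfl⟩ := hs'
    obtain ⟨h1, h2⟩ := key c hc c' hc' b hb b' hb' h
    exact ⟨by rw [h1], by rw [h2]⟩)
  refine ⟨F, ?_, hprop⟩
  rw [hTcard, hScard] at hF
  exact hF

end Summit.MatrixMultiplication.MatrixMultiplication.Theorems.LevelOneGL2Designs.CyclotomicLift
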